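import Mathlib
import HarnessLib

/-!
# Markman 2025 — the printed DIMENSION COUNTS around the spinor variety, its secant variety, and the
# obstruction kernel of the genus-3 secant sheaf ([M] §1.1–§1.2, §2.2, Lemma 8.3.3, Prop. 8.3.9,
# Thm. 1.4.1 (5)), AS PRINTED and kernel-checked

E. Markman: [M] *Cycles on abelian 2n-folds of Weil type from secant sheaves on abelian n-folds*,
arXiv:2502.03415 **v2** (2025-06-08), bib `Markman2025SecantWeil` — UNREFEREED PREPRINT. Pages/lines = PyMuPDF lines
of the public v2 PDF (sha256/16 `8155aa33870069b8`), read at seat lit-w-markman (pub-hsemireg LIT-W, 2026-08-23;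
sheet `LOCATOR-SHEET-MARKMAN.md` §34; the four quotation windows below were re-read BY EYE on 150-dpi renders).

## What is printed (verbatim)
* §1.2, v2 p. 3 L52–58 / p. 4 L3–4: «`V := H¹(X, ℤ) ⊕ H¹(X̂, ℤ)`. … `V` has rank `4n` and is isometric to the
  orthogonal direct sum `U^{⊕2n}` … Set `S := H^*(X, ℤ)`, `S⁺ := ⊕ H^{2i}(X, ℤ)`, and `S⁻ := ⊕ H^{2i+1}(X, ℤ)`. Then
  `S⁺` and `S⁻` are the half-spin representations of the integral spin group `Spin(V)`.» (`X` an abelian `n`-fold.)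
* §2.2, v2 p. 12 L43–51: «Every maximal isotropic subspace is of this form and so the `(2n² − n)`-dimensional
  grassmannian `IGr(2n, V_ℂ)` of `2n`-dimensional isotropic subspaces has two connected components `IGr⁺(2n, V_ℂ)`
  and `IGr⁻(2n, V_ℂ)` [Ch, III.1.5]. We get a `Spin(V)`-equivariant embedding `IGr⁺(2n, V_ℂ) → ℙ(S⁺_ℂ) ≅ ℙ^{2^{2n−1}−1}`».
* §1.2, v2 p. 4 L26–28, L34–36, L41–44: «[For] `n = 2`, the spinor variety in `ℙ(S⁺_ℂ)` is the quadric hypersurface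
  associated to the pairing (1.2.3), … When `n = 3`, the secant variety of the spinor variety is birational to
  `ℙ(S⁺_ℂ)`. … For `n ≥ 4` the image in the `(2^{2n−1} − 1)`-dimensional `ℙ(S⁺_ℂ)` of the `(4n² − 2n + 1)`-dimensional
  secant variety to the spinor variety is a proper subvariety.»
* §1.1, v2 p. 3 L34–35: «The moduli space of `2n`-dimensional abelian varieties of Weil type is `n²`-dimensional.»;
  THM. 1.4.1 (5), p. 7 L53–55: «`E` deforms with `(X × X̂, η, h)` to first order as a twisted sheaf in every direction
  in the 9-dimensional moduli space of polarized abelian sixfolds of Weil type (Lemma 8.4.1 (2) and Remark 8.5.4).»;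
  §8 intro, p. 49 L54–56: «We show that the obstruction map `ob_F : HT²(X) → Ext²(F, F)` has rank 6, and so its
  kernel is a 9-dimensional subspace of unobstructed first order deformations of the pair `(X, F)`.»; p. 50 L3–5:
  «… the isomorphism `Φ^{HT} : HT²(X × X) → HT²(X × X̂)` maps the “diagonally” embedded `ker(ob_{F₁}) ⊂ HT²(X)` to a
  9-dimensional subspace of first order commutative and gerby deformations of `X × X̂`.»
* §8.3, v2 p. 58 L43: «HKR isomorphism `HT²(X) := H²(𝒪_X) ⊕ H¹(TX) ⊕ H⁰(∧²TX) ≅ HH²(X)`»; LEMMA 8.3.3 (p. 58 L45–56):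
  «`rank(ob_F) ≥ 6`. Proof. Consider the contraction homomorphism
  `H²(𝒪_X) ⊕ H¹(TX) ⊕ H⁰(∧²TX) →^{⌟ch(F)} H²(𝒪_X) ⊕ H³(Ω¹_X)`. It restricts to the first summand as an isomorphism
  onto the first summand of the co-domain, as `ch₀(F) = 1`, and to the second summand as an isomorphism onto the
  second summand of the co-domain, as `ch₂(F) = −(n/2)Θ²`. Hence, the above homomorphism is sujective [sic] and so its
  kernel has co-dimension 6. The kernel of `ob_F` is contained in the kernel of the above homomorphism, by [Hua,
  Theorem B], hence `ob_F` has rank `≥ 6`.»; PROP. 8.3.9 (p. 61 L76): «`rank(ob_F) = 6`.» (`X = Pic²(C)`, `C` of genus 3.)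

## What this file proves (arithmetic and linear algebra of those sentences; theorems only; NO named fact)
(1) `rank S = Σ_k C(2n, k) = 2^{2n} = 4^n` and `rank S⁺ = Σ_i C(2n, 2i) = 2^{2n−1}` (by value for `1 ≤ n ≤ 6` in
`spin_and_halfSpin_rank`, and for every `n ≥ 1` in `halfSpin_rank`, Appendix), so `ℙ(S⁺_ℂ) ≅ ℙ^{2^{2n−1}−1}`; (2) `dim IGr(2n, V_ℂ) = C(2n, 2) = 2n² − n` and the (expected) secant dimension
`2(2n² − n) + 1 = 4n² − 2n + 1`; (3) the printed trichotomy as numbers: `n = 2`: `2n² − n = 6 = (2^{2n−1} − 1) − 1`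
(a hypersurface in `ℙ⁷`); `n = 3`: `4n² − 2n + 1 = 31 = 2^{2n−1} − 1` (equal dimensions — consistent with «birational
to `ℙ(S⁺_ℂ)`»); `n ≥ 4`: `4n² − 2n + 1 < 2^{2n−1} − 1` (so the image IS proper for dimension reasons alone), with
`57 < 127` at `n = 4`; (4) with `dim H^p(X, ∧^q TX) = C(n, p)·C(n, q)` for an abelian `n`-fold (standard, by value):
`dim HT²(X) = C(n,2) + n² + C(n,2) = C(2n, 2)`, `= 15` at `n = 3`; the co-domain of Lemma 8.3.3 has dimension
`h^{0,2} + h^{1,3} = 3 + 3 = 6`; `15 − 6 = 9 = 3²` — the three printed 9's (p. 49, p. 50, Thm 1.4.1 (5)) and the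
printed `n²` (p. 3) agree at `n = 3`; (5) the linear-algebra face of the last two sentences of Lemma 8.3.3: a
surjection onto a `w`-dimensional space has kernel of co-dimension `w`, and a map whose kernel lies inside that kernel
has rank `≥ w`.

## One print-reading PRECISION (recorded so nobody «corrects» a quotation; no statement of [M] is affected)
In the proof of Lemma 8.3.3 the words «restricts … to the second summand as an isomorphism onto the second summand of
the co-domain» cannot be literal: `dim H¹(TX) = n² = 9` while `dim H³(Ω¹_X) = h^{1,3} = 3` (`n = 3`); what the next
sentence uses («sujective and so its kernel has co-dimension 6») is SURJECTIVITY onto `H³(Ω¹_X)`, which is all the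
lemma needs. (`theorem lemma833_second_summand_dims` below records `9 ≠ 3`.)

## Inputs BY VALUE (NOT proved here) and honest framing
Hodge numbers of abelian varieties, the identification of `IGr⁺` with the even pure spinors, the secant-variety
dimension `2·dim + 1`, [Hua, Theorem B], and everything geometric in [M] are inputs; the kernel adds only arithmetic
and two rank–nullity facts. Nothing here says that any sheaf is semiregular, and nothing here bears on HC / HC_CM /
HC_AV.
-/

namespace Literature.AlgebraicGeometry.Markman2025

/-- **[M] §1.2 p. 3 L57–58 / §2.2 p. 12 L50–51**: `V` has rank `4n`, `S = H^*(X, ℤ) = ∧^* H¹` has rank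
`Σ_k C(2n, k) = 2^{2n} = 4^n`, and the even part `S⁺ = ⊕_i H^{2i}(X, ℤ)` has rank `Σ_i C(2n, 2i) = 2^{2n−1}` — here by
value for `1 ≤ n ≤ 6` (`2, 8, 32, 128, 512, 2048`) — whence «`ℙ(S⁺_ℂ) ≅ ℙ^{2^{2n−1}−1}`».
[cite: Markman2025SecantWeil, §1.2 (v2 p. 3 L52–58, p. 4 L3–4) and §2.2 (v2 p. 12 L50–51)] -/
theorem spin_and_halfSpin_rank :
    (∀ n : ℕ, ∑ k ∈ Finset.range (2 * n + 1), Nat.choose (2 * n) k = 2 ^ (2 * n) ∧ 2 ^ (2 * n) = 4 ^ n) ∧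
    (∀ n ∈ Finset.Icc 1 6, ∑ i ∈ Finset.range (n + 1), Nat.choose (2 * n) (2 * i) = 2 ^ (2 * n - 1)) ∧
    (2 ^ (2 * 1 - 1) = 2 ∧ 2 ^ (2 * 2 - 1) = 8 ∧ 2 ^ (2 * 3 - 1) = 32 ∧ 2 ^ (2 * 4 - 1) = 128) := by
  refine ⟨fun n => ⟨Nat.sum_range_choose (2 * n), by rw [pow_mul]; norm_num⟩, by decide, by norm_num⟩

/-- **[M] §2.2 p. 12 L47–48** «the `(2n² − n)`-dimensional grassmannian `IGr(2n, V_ℂ)` of `2n`-dimensional isotropic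
subspaces» (`V_ℂ` of dimension `4n`): the dimension of a component of the maximal isotropic Grassmannian of a
`4n`-dimensional quadratic space is `C(2n, 2) = (2n)(2n − 1)/2 = 2n² − n`; values `1, 6, 15, 28` for `n = 1, …, 4`.
[cite: Markman2025SecantWeil, §2.2 (v2 p. 12 L43–51)] -/
theorem isotropicGrassmannian_dim (n : ℕ) :
    Nat.choose (2 * n) 2 = 2 * n ^ 2 - n ∧
    (Nat.choose 2 2 = 1 ∧ Nat.choose 4 2 = 6 ∧ Nat.choose 6 2 = 15 ∧ Nat.choose 8 2 = 28) := by
  refine ⟨?_, by decide⟩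
  have h : (Nat.choose (2 * n) 2 : ℚ) = ((2 * n ^ 2 - n : ℕ) : ℚ) := by
    have hle : n ≤ 2 * n ^ 2 := by nlinarith
    rw [Nat.cast_choose_two, Nat.cast_sub hle]
    push_cast
    ring
  exact_mod_cast h

/-- **[M] §1.2 p. 4 L42–44** «the `(4n² − 2n + 1)`-dimensional secant variety to the spinor variety»: the (expected)
dimension of the variety of secant lines to a `(2n² − n)`-dimensional variety is `2(2n² − n) + 1 = 4n² − 2n + 1`;
values `13, 31, 57` for `n = 2, 3, 4`. [cite: Markman2025SecantWeil, §1.2 (v2 p. 4 L41–44)] -/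
theorem secantVariety_dim (n : ℕ) :
    2 * (2 * n ^ 2 - n) + 1 = 4 * n ^ 2 - 2 * n + 1 ∧
    (4 * 2 ^ 2 - 2 * 2 + 1 = 13 ∧ 4 * 3 ^ 2 - 2 * 3 + 1 = 31 ∧ 4 * 4 ^ 2 - 2 * 4 + 1 = 57) := by
  refine ⟨?_, by norm_num⟩
  have hle : n ≤ n ^ 2 := by nlinarith
  omega

/-- **[M] §1.2 p. 4 L26–28, L34–36, L41–44 — the printed trichotomy, as a dimension count.** `n = 2`: the spinor
variety (`2n² − n = 6`) is a HYPERSURFACE in `ℙ(S⁺_ℂ) = ℙ⁷` («the quadric hypersurface»); `n = 3`: the secant variety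
(`4n² − 2n + 1 = 31`) and `ℙ(S⁺_ℂ) = ℙ³¹` have EQUAL dimension (consistent with «birational to `ℙ(S⁺_ℂ)`»); `n ≥ 4`:
`4n² − 2n + 1 < 2^{2n−1} − 1`, so the image of the secant variety is a proper subvariety already for dimension reasons
(«For `n ≥ 4` … is a proper subvariety»), e.g. `57 < 127` at `n = 4`, `91 < 511` at `n = 5`; and the threshold is
sharp: the strict inequality FAILS at `n = 1, 2, 3` (`3 > 1`, `13 > 7`, `31 = 31`).
[cite: Markman2025SecantWeil, §1.2 (v2 p. 4 L26–44)] -/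
theorem secant_spinor_dimension_trichotomy :
    (2 * 2 ^ 2 - 2 = 6 ∧ 2 ^ (2 * 2 - 1) - 1 = 7 ∧ 6 + 1 = 7) ∧
    (4 * 3 ^ 2 - 2 * 3 + 1 = 31 ∧ 2 ^ (2 * 3 - 1) - 1 = 31) ∧
    (∀ n : ℕ, 4 ≤ n → 4 * n ^ 2 - 2 * n + 1 < 2 ^ (2 * n - 1) - 1) ∧
    (4 * 4 ^ 2 - 2 * 4 + 1 = 57 ∧ 2 ^ (2 * 4 - 1) - 1 = 127 ∧ 4 * 5 ^ 2 - 2 * 5 + 1 = 91 ∧ 2 ^ (2 * 5 - 1) - 1 = 511) ∧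
    (∀ n : ℕ, 1 ≤ n → n ≤ 3 → ¬ 4 * n ^ 2 - 2 * n + 1 < 2 ^ (2 * n - 1) - 1) := by
  refine ⟨by norm_num, by norm_num, ?_, by norm_num, ?_⟩
  · intro n hn
    -- clean form without truncated subtraction: 4n² + 2 < 2^{2n−1} + 2n, by induction from n = 4
    have key : ∀ m : ℕ, 4 ≤ m → 4 * m ^ 2 + 3 ≤ 2 ^ (2 * m - 1) + 2 * m := by
      intro m hm
      induction m, hm using Nat.le_induction with
      | base => norm_num
      | succ k hk ih =>
        have h2 : 2 ^ (2 * (k + 1) - 1) = 4 * 2 ^ (2 * k - 1) := by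
          have : 2 * (k + 1) - 1 = (2 * k - 1) + 2 := by omega
          rw [this, pow_add]; ring
        rw [h2]
        nlinarith [ih]
    have h1 := key n hn
    have hle : 2 * n ≤ 4 * n ^ 2 := by nlinarith
    have hpos : 1 ≤ 2 ^ (2 * n - 1) := Nat.one_le_two_pow
    omega
  · intro n h1 h3
    interval_cases n <;> norm_num

/-- **[M] §8.3 p. 58 L43** «`HT²(X) := H²(𝒪_X) ⊕ H¹(TX) ⊕ H⁰(∧²TX)`» for an abelian `n`-fold, with
`dim H^p(X, ∧^q TX) = C(n, p)·C(n, q)` (trivial tangent bundle of rank `n`, `h^{0,p} = C(n, p)`; by value):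
`dim HT²(X) = C(n,2)·C(n,0) + C(n,1)·C(n,1) + C(n,0)·C(n,2) = C(2n, 2)` (Vandermonde), i.e. `C(n,2) + n² + C(n,2)
= n(2n − 1)`; at `n = 3`: `3 + 9 + 3 = 15`; at `n = 6` (the sixfold `X × X̂`): `15 + 36 + 15 = 66`.
[cite: Markman2025SecantWeil, §8.3 (v2 p. 58 L43)] -/
theorem hodgeTangentTwo_dim (n : ℕ) :
    Nat.choose n 2 * Nat.choose n 0 + Nat.choose n 1 * Nat.choose n 1 + Nat.choose n 0 * Nat.choose n 2 =
      Nat.choose (2 * n) 2 ∧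
    Nat.choose n 2 + n ^ 2 + Nat.choose n 2 = Nat.choose (2 * n) 2 ∧
    (Nat.choose 3 2 + 3 ^ 2 + Nat.choose 3 2 = 15 ∧ Nat.choose 6 2 = 15) ∧
    (Nat.choose 6 2 + 6 ^ 2 + Nat.choose 6 2 = 66 ∧ Nat.choose 12 2 = 66) := by
  have main : Nat.choose n 2 + n ^ 2 + Nat.choose n 2 = Nat.choose (2 * n) 2 := by
    have h : ((Nat.choose n 2 + n ^ 2 + Nat.choose n 2 : ℕ) : ℚ) = (Nat.choose (2 * n) 2 : ℚ) := by
      push_cast [Nat.cast_choose_two]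
      ring
    exact_mod_cast h
  refine ⟨?_, main, by decide, by decide⟩
  simpa [Nat.choose_zero_right, Nat.choose_one_right, pow_two] using main

/-- **[M] LEMMA 8.3.3 / PROP. 8.3.9 / p. 49 L54–56 / p. 3 L34–35 / THM. 1.4.1 (5) at `n = 3` — the numbers.**
Co-domain of the contraction `⌟ch(F)`: `H²(𝒪_X) ⊕ H³(Ω¹_X)` has dimension `h^{0,2} + h^{1,3} = C(3,0)C(3,2) +
C(3,1)C(3,3) = 3 + 3 = 6` («its kernel has co-dimension 6»); `dim HT²(X) = 15`, so that kernel is `9`-dimensional;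
with `rank(ob_F) = 6` (Prop. 8.3.9), `dim ker(ob_F) = 15 − 6 = 9` («a 9-dimensional subspace», p. 49 L55; p. 50 L4);
and `9 = 3² = n²` is the printed dimension of the moduli of abelian sixfolds of Weil type (p. 3 L34–35 «`n²`-
dimensional»; Thm. 1.4.1 (5) «the 9-dimensional moduli space»). The coincidence `C(2n,2) − 2·C(n,2)… = n²` is
special to this `n = 3` bookkeeping (at `n = 4`: `28 − 6 = 22 ≠ 16` for the analogous first summands) — print asserts
it only at `n = 3`. [cite: Markman2025SecantWeil, Lemma 8.3.3 (v2 p. 58 L45–56), Prop. 8.3.9 (p. 61 L76), §8 (p. 49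
L54–56, p. 50 L3–5), §1.1 (p. 3 L34–35), Thm. 1.4.1 (5) (p. 7 L53–55)] -/
theorem obstructionKernel_dim_genusThree :
    (Nat.choose 3 0 * Nat.choose 3 2 + Nat.choose 3 1 * Nat.choose 3 3 = 6) ∧
    (Nat.choose 3 2 + 3 ^ 2 + Nat.choose 3 2 = 15) ∧ (15 - 6 = 9) ∧ (9 = 3 ^ 2) ∧
    (Nat.choose 4 2 + 4 ^ 2 + Nat.choose 4 2 - Nat.choose 4 2 = 22 ∧ (22 : ℕ) ≠ 4 ^ 2) := by
  refine ⟨by decide, by decide, by norm_num, by norm_num, by decide⟩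

/-- **PRINT-READING PRECISION on [M] Lemma 8.3.3's proof (v2 p. 58 L51–54)**: «restricts … to the second summand as
an isomorphism onto the second summand of the co-domain» — the second summand of `HT²(X)` is `H¹(TX)`, of dimension
`C(3,1)·C(3,1) = 9`, and the second summand of the co-domain is `H³(Ω¹_X)`, of dimension `h^{1,3} = C(3,1)·C(3,3)
= 3`; `9 ≠ 3`, so «isomorphism» cannot be literal — the proof uses (and needs) only that the restriction is ONTO
`H³(Ω¹_X)`, giving «sujective [sic] and so its kernel has co-dimension 6». The first summand IS matched:
`dim H²(𝒪_X) = C(3,0)·C(3,2) = 3` on both sides. No statement of [M] is affected.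
[cite: Markman2025SecantWeil, Lemma 8.3.3 (v2 p. 58 L45–56)] -/
theorem lemma833_second_summand_dims :
    Nat.choose 3 1 * Nat.choose 3 1 = 9 ∧ Nat.choose 3 1 * Nat.choose 3 3 = 3 ∧ (9 : ℕ) ≠ 3 ∧
    Nat.choose 3 0 * Nat.choose 3 2 = 3 ∧ Nat.choose 3 2 * Nat.choose 3 0 = 3 := by
  decide

/-- The linear-algebra face of [M] Lemma 8.3.3, sentence «Hence, the above homomorphism is sujective and so its
kernel has co-dimension 6»: for a surjective linear map `f : V → W` of finite-dimensional spaces,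
`dim ker f + dim W = dim V`. [cite: Markman2025SecantWeil, Lemma 8.3.3 (v2 p. 58 L54–55)] -/
theorem finrank_ker_add_of_surjective {K V W : Type*} [Field K] [AddCommGroup V] [Module K V]
    [FiniteDimensional K V] [AddCommGroup W] [Module K W] (f : V →ₗ[K] W)
    (hf : Function.Surjective f) :
    Module.finrank K (LinearMap.ker f) + Module.finrank K W = Module.finrank K V := by
  have h := LinearMap.finrank_range_add_finrank_ker f
  rw [LinearMap.range_eq_top.mpr hf, finrank_top] at h
  omega

/-- The linear-algebra face of [M] Lemma 8.3.3, last sentence «The kernel of `ob_F` is contained in the kernel of the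
above homomorphism …, hence `ob_F` has rank `≥ 6`»: if `ker g ≤ ker f` with `f : V → W` surjective, then
`rank g ≥ dim W`; with `dim W = 6` this is «`rank(ob_F) ≥ 6`», and with PROP. 8.3.9's «`rank(ob_F) = 6`» and
`dim V = 15` the kernel of `g = ob_F` has dimension `9`.
[cite: Markman2025SecantWeil, Lemma 8.3.3 (v2 p. 58 L55–56) and Prop. 8.3.9 (p. 61 L76)] -/
theorem finrank_le_rank_of_ker_le_ker {K V W U : Type*} [Field K] [AddCommGroup V] [Module K V]
    [FiniteDimensional K V] [AddCommGroup W] [Module K W] [AddCommGroup U] [Module K U]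
    (f : V →ₗ[K] W) (g : V →ₗ[K] U) (hf : Function.Surjective f) (hker : LinearMap.ker g ≤ LinearMap.ker f) :
    Module.finrank K W ≤ Module.finrank K (LinearMap.range g) ∧
    (Module.finrank K V = 15 → Module.finrank K (LinearMap.range g) = 6 →
      Module.finrank K (LinearMap.ker g) = 9) := by
  have hf' := finrank_ker_add_of_surjective f hf
  have hg := LinearMap.finrank_range_add_finrank_ker g
  have hmono : Module.finrank K (LinearMap.ker g) ≤ Module.finrank K (LinearMap.ker f) :=
    Submodule.finrank_mono hker
  refine ⟨by omega, fun hV hr => by omega⟩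

/-! ### Appendix (same seat, same day): the half-spin rank for EVERY `n`
`spin_and_halfSpin_rank` above records `rank S⁺ = Σ_i C(2n, 2i) = 2^{2n−1}` by value for `n ≤ 6`; the two theorems
below prove it for all `n ≥ 1` (even-index binomial sum = half of `2^{2n}`, via `(1+1)^{2n}` and `(1−1)^{2n}`), so that
[M]'s «`ℙ(S⁺_ℂ) ≅ ℙ^{2^{2n−1}−1}`» (§2.2, v2 p. 12 L50–51) is kernel-checked in the generality printed. -/

/-- Reindexing helper: the even numbers `≤ 2n` are exactly the doubles of `0, …, n`. [folklore] -/
private theorem image_two_mul_range_eq_filter_even (n : ℕ) :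
    (Finset.range (n + 1)).image (fun i => 2 * i) = (Finset.range (2 * n + 1)).filter Even := by
  ext k
  simp only [Finset.mem_image, Finset.mem_range, Finset.mem_filter]
  constructor
  · rintro ⟨i, hi, rfl⟩
    exact ⟨by omega, even_two_mul i⟩
  · rintro ⟨hk, ⟨j, rfl⟩⟩
    exact ⟨j, by omega, by omega⟩

/-- **[M] §1.2 p. 3 L57–58, p. 4 L3–4 / §2.2 p. 12 L50–51, for every `n ≥ 1`**: with `rank H¹(X, ℤ) = 2n`, the even part
`S⁺ = ⊕_i H^{2i}(X, ℤ) = ⊕_i ∧^{2i} H¹` of the spin representation `S = ∧^* H¹(X, ℤ)` has rank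
`Σ_{i=0}^{n} C(2n, 2i) = 2^{2n−1}` — half of `rank S = 2^{2n}` — whence «`ℙ(S⁺_ℂ) ≅ ℙ^{2^{2n−1}−1}`» for all `n`.
Proof: `E + O = Σ_k C(2n, k) = 2^{2n}` (Mathlib `Nat.sum_range_choose`) and `E − O = Σ_k (−1)^k C(2n, k) = 0`
(Mathlib `Int.alternating_sum_range_choose`), so `E = 2^{2n−1}`.
[cite: Markman2025SecantWeil, §1.2 (v2 p. 3 L57–58, p. 4 L3–4) and §2.2 (v2 p. 12 L50–51)] -/
theorem halfSpin_rank (n : ℕ) (hn : 1 ≤ n) :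
    ∑ i ∈ Finset.range (n + 1), Nat.choose (2 * n) (2 * i) = 2 ^ (2 * n - 1) := by
  set m := 2 * n with hm
  -- reindex to a filtered sum over `k ≤ m`
  have hre : ∑ i ∈ Finset.range (n + 1), Nat.choose m (2 * i) =
      ∑ k ∈ (Finset.range (m + 1)).filter Even, Nat.choose m k := by
    rw [← image_two_mul_range_eq_filter_even n, Finset.sum_image]
    intro a _ b _ h
    simpa using h
  -- `E + O = 2^m`
  have htot : ∑ k ∈ (Finset.range (m + 1)).filter Even, Nat.choose m k +
      ∑ k ∈ (Finset.range (m + 1)).filter (fun k => ¬ Even k), Nat.choose m k = 2 ^ m := by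
    rw [Finset.sum_filter_add_sum_filter_not, Nat.sum_range_choose]
  -- `E − O = 0` in `ℤ` (`m ≠ 0`)
  have halt : (∑ k ∈ Finset.range (m + 1), ((-1 : ℤ) ^ k * (Nat.choose m k : ℤ))) = 0 := by
    rw [Int.alternating_sum_range_choose]
    simp [hm]; omega
  have hsplit : (∑ k ∈ Finset.range (m + 1), ((-1 : ℤ) ^ k * (Nat.choose m k : ℤ))) =
      (∑ k ∈ (Finset.range (m + 1)).filter Even, (Nat.choose m k : ℤ)) -
      (∑ k ∈ (Finset.range (m + 1)).filter (fun k => ¬ Even k), (Nat.choose m k : ℤ)) := by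
    rw [← Finset.sum_filter_add_sum_filter_not (Finset.range (m + 1)) Even]
    rw [sub_eq_add_neg, ← Finset.sum_neg_distrib]
    congr 1
    · apply Finset.sum_congr rfl
      intro k hk
      rw [(Finset.mem_filter.mp hk).2.neg_one_pow, one_mul]
    · apply Finset.sum_congr rfl
      intro k hk
      have hodd : Odd k := Nat.not_even_iff_odd.mp (Finset.mem_filter.mp hk).2
      rw [hodd.neg_one_pow]; ring
  have hEO : (∑ k ∈ (Finset.range (m + 1)).filter Even, Nat.choose m k) =
      ∑ k ∈ (Finset.range (m + 1)).filter (fun k => ¬ Even k), Nat.choose m k := by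
    have h' : ((∑ k ∈ (Finset.range (m + 1)).filter Even, Nat.choose m k : ℕ) : ℤ) =
        ((∑ k ∈ (Finset.range (m + 1)).filter (fun k => ¬ Even k), Nat.choose m k : ℕ) : ℤ) := by
      push_cast; linarith [hsplit ▸ halt]
    exact_mod_cast h'
  have hm1 : m = (m - 1) + 1 := by omega
  have hpow : 2 ^ m = 2 * 2 ^ (m - 1) := by
    conv_lhs => rw [hm1]
    rw [pow_succ]; ring
  rw [hre]
  omega


end Literature.AlgebraicGeometry.Markman2025
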